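import Mathlib
import HarnessLib
import Literature.MathematicalPhysics.QuantumLattice.HubbardEffectiveActionCTSpinFlip
import Summits.HubbardSuperconductivity.HubbardSuperconductivity.Theorems.KLProgrammeKLRegimeEngineQuarticSpinWard
import Summits.HubbardSuperconductivity.HubbardSuperconductivity.Theorems.KLProgrammeKLRegimeEngineFixedTuplePerm

/-!
# Route `KLProgramme` — ENGINE item stmt-HubbardSuperconductivity-20437, class #6 / (E5-F)ₙ producer, route (M), strand M4 (i) AT THE `L¹` LEVEL:
# every spin/charge pattern of the class-#6 size `fixedTupleL1` from the ONE standard pattern `(ψ⁺_↑, ψ⁻_↑, ψ⁺_↓, ψ⁻_↓)` — factor `2`, no kernel sups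

Cell gate-hubbard-kl, seat hubbard-kl-k3c2-p2 (g12; owner-designate of M1 + M3 of route (M), pen (R59az)).  The M3 shape of this lineage
(`fixedTupleL1_klIsoKernelAt_le_of_value_moments_counts`, `…_le_regime`) is stated for BGM-ordered iso tuples with the spins `(0,0,1,1)` of the (E5-F) value
`klQuarticValue … n 0 1`; the class-#6 text `IsoTupleLineAt` and (E5-F)ₙ quantify over EVERY label 4-tuple.  p1b g12's `…EngineIsoValuePatterns` (p571792) does the
reduction for the BARE momentum kernel on a window `A⁴`; this file does it one level up, for the sectorised position-space kernels and their pinned `L¹` sizes, where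
it is pure bookkeeping and needs no sup of any kernel:

* §1 `sectorisedKernel_klEffectiveAction_spinFlip` (the sectorised kernels of `𝒱ₙ[K]` are invariant under the global spin flip of the labels — the multipliers and
  plane waves do not read the spin), **`sectorisedKernel_klEffectiveAction_sameSpin`** — the quartic `SU(2)` Ward identity AT THE SECTORISED LEVEL, pointwise in the
  positions: `W_{(+↑,−↑,+↑,−↑)}(x) = W_{(+↑,−↑,+↓,−↓)}(x) + W_{(+↓,−↑,+↑,−↓)}(x)` (same sector string; `kernel_hubbardEffectiveActionCT_quartic_spinWard` inside the
  momentum sum, the exchanged term re-read through antisymmetry `kernel_comp_perm` at the SAME momentum string — no reindexing);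
* §2 `fixedTupleL1_sectorisedKernel_eq_zero_of_forall`, **`fixedTupleL1_sectorisedKernel_klEffectiveAction_stdCharge_le_two_mul`** (charges `(+,−,+,−)`, ANY spins:
  `≤ 2·S` from the standard-pattern bound `S` over all sector strings and pins — ten patterns vanish by `S_z`, `(↓,↓,↑,↑)` is the spin flip, `(↑,↓,↓,↑)`/`(↓,↑,↑,↓)`
  are leg transpositions `fixedTupleL1_sectorisedKernel_comp_perm`, the equal-spin ones are §1's sum of two);
* §3 **`fixedTupleL1_sectorisedKernel_klEffectiveAction_le_two_mul_of_std`** (ANY charges: unbalanced tuples vanish, balanced ones are leg permutations of §2) and the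
  class-#6 instance **`fixedTupleL1_klIsoKernelAt_le_two_mul_of_std`**: if every STANDARD iso tuple (sectors `ω`, spins `(0,0,1,1)`, charges `(0,1,0,1)`) has
  `fixedTupleL1 β 3 (klIsoKernelAt … K n m) Ω_std x₁ ≤ S` at every pin, then EVERY label 4-tuple has `fixedTupleL1 … Ω x₁ ≤ 2·S`.

So the M3 assembly and M2's moments are needed for the standard pattern ONLY.  Everything is proved; no definitions; nothing about the model is asserted beyond
its exact symmetries.  References: BGM 2006 §2.1 symmetries (1)–(3), §2.3 (2.25), §2.7 (2.70)–(2.71a) [cite: BenfattoGiulianiMastropietro2006].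
-/

noncomputable section

namespace Summit.HubbardSuperconductivity.HubbardSuperconductivity.Theorems.EngineV8

set_option linter.dupNamespace false -- summit = problem name (single-conjunct summit), D-0017

open Classical
open Real Finset Complex Literature.MathematicalPhysics.QuantumLattice Literature.Probability.LatticeModels GrassmannAlgebra
open Summit.HubbardSuperconductivity.HubbardSuperconductivity.Theorems.KLProgrammeLegKernels
open Summit.HubbardSuperconductivity.HubbardSuperconductivity.Theorems.KLRegimeSplit
open Summit.HubbardSuperconductivity.HubbardSuperconductivity.Theorems.KLRegimeWick

variable {L M : ℕ} [NeZero L] [NeZero M]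

/-! ## §1 Spin flip and the Ward identity at the sectorised level -/

section Symmetries

variable {N : ℕ}

omit [NeZero M] in
/-- **The sectorised kernels of `𝒱ₙ[K]` are invariant under the global spin flip of the labels** (the multipliers and the plane waves read sector and charge only;
`kernel_hubbardEffectiveActionCT_spinFlip`). -/
theorem sectorisedKernel_klEffectiveAction_spinFlip (β : ℝ) (F : Fin N → FreqMomentum L M → ℂ) (U μ : ℝ) (K : TrigPolyC4v) (e₀ : ℝ) (n : ℕ) {m : ℕ}
    (Ω : Fin m → SectorLeg N) (x : Fin m → SpaceTimeIdx L M) :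
    sectorisedKernel L M β F (klEffectiveAction L M β U μ K e₀ n) m (fun i => (((Ω i).1.1, Equiv.swap (0 : Fin 2) 1 (Ω i).1.2), (Ω i).2)) x =
      sectorisedKernel L M β F (klEffectiveAction L M β U μ K e₀ n) m Ω x := by
  rw [sectorisedKernel_def, sectorisedKernel_def]
  refine sum_congr rfl fun k _ => ?_
  have h := kernel_hubbardEffectiveActionCT_spinFlip L M β U μ K (klScale e₀ n) m (fun i => ((k i, (Ω i).1.2), (Ω i).2))
  simp only [klEffectiveAction]
  exact congrArg _ h

omit [NeZero M] in
/-- **THE QUARTIC `SU(2)` WARD IDENTITY AT THE SECTORISED LEVEL** (charges `(+,−,+,−)`, one sector string `ω`, pointwise in the positions):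
`W_{(↑,↑,↑,↑)}(x) = W_{(↑,↑,↓,↓)}(x) + W_{(↓,↑,↑,↓)}(x)`.  Inside the momentum sum this is `F₄(↑↑↑↑)(k) = F₄(↑↑↓↓)(k) − F₄(↑↑↓↓)(k ∘ (0 2))` with the exchanged
term equal to `−F₄(↓↑↑↓)(k)` by antisymmetry. -/
theorem sectorisedKernel_klEffectiveAction_sameSpin (β : ℝ) (F : Fin N → FreqMomentum L M → ℂ) (U μ : ℝ) (K : TrigPolyC4v) (e₀ : ℝ) (n : ℕ)
    (ω : Fin 4 → Fin N) (x : Fin 4 → SpaceTimeIdx L M) :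
    sectorisedKernel L M β F (klEffectiveAction L M β U μ K e₀ n) 4 (fun i => ((ω i, 0), ![(0 : Fin 2), 1, 0, 1] i)) x =
      sectorisedKernel L M β F (klEffectiveAction L M β U μ K e₀ n) 4 (fun i => ((ω i, ![(0 : Fin 2), 0, 1, 1] i), ![(0 : Fin 2), 1, 0, 1] i)) x +
        sectorisedKernel L M β F (klEffectiveAction L M β U μ K e₀ n) 4 (fun i => ((ω i, ![(1 : Fin 2), 0, 0, 1] i), ![(0 : Fin 2), 1, 0, 1] i)) x := by
  set G := klEffectiveAction L M β U μ K e₀ n with hG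
  rw [sectorisedKernel_def, sectorisedKernel_def, sectorisedKernel_def, ← sum_add_distrib]
  refine sum_congr rfl fun k _ => ?_
  -- the three label strings in `![…]` form
  have e0 : (fun i : Fin 4 => ((k i, (0 : Fin 2)), ![(0 : Fin 2), 1, 0, 1] i)) =
      ![((k 0, 0), 0), ((k 1, 0), 1), ((k 2, 0), 0), ((k 3, 0), 1)] := by funext i; fin_cases i <;> rfl
  have e1 : (fun i : Fin 4 => ((k i, ![(0 : Fin 2), 0, 1, 1] i), ![(0 : Fin 2), 1, 0, 1] i)) =
      ![((k 0, 0), 0), ((k 1, 0), 1), ((k 2, 1), 0), ((k 3, 1), 1)] := by funext i; fin_cases i <;> rfl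
  have e2 : (![((k 0, 1), 0), ((k 1, 0), 1), ((k 2, 0), 0), ((k 3, 1), 1)] : Fin 4 → HubbardFieldIdx L M) ∘ (Equiv.swap (0 : Fin 4) 2) =
      ![((k 2, 0), 0), ((k 1, 0), 1), ((k 0, 1), 0), ((k 3, 1), 1)] := by funext i; fin_cases i <;> rfl
  have e3 : (fun i : Fin 4 => ((k i, ![(1 : Fin 2), 0, 0, 1] i), ![(0 : Fin 2), 1, 0, 1] i)) =
      ![((k 0, 1), 0), ((k 1, 0), 1), ((k 2, 0), 0), ((k 3, 1), 1)] := by funext i; fin_cases i <;> rfl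
  have hW : kernel ℂ G 4 ![((k 0, 0), 0), ((k 1, 0), 1), ((k 2, 0), 0), ((k 3, 0), 1)] =
      kernel ℂ G 4 ![((k 0, 0), 0), ((k 1, 0), 1), ((k 2, 1), 0), ((k 3, 1), 1)] -
        kernel ℂ G 4 ![((k 2, 0), 0), ((k 1, 0), 1), ((k 0, 1), 0), ((k 3, 1), 1)] :=
    kernel_hubbardEffectiveActionCT_quartic_spinWard L M β U μ K (klScale e₀ n) (k 0) (k 1) (k 2) (k 3)
  have hX : kernel ℂ G 4 ![((k 2, 0), 0), ((k 1, 0), 1), ((k 0, 1), 0), ((k 3, 1), 1)] =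
      -kernel ℂ G 4 ![((k 0, 1), 0), ((k 1, 0), 1), ((k 2, 0), 0), ((k 3, 1), 1)] := by
    rw [← e2, kernel_comp_perm (R := ℂ), Equiv.Perm.sign_swap (by decide)]
    simp
  rw [e0, e1, e3, hW, hX, sub_neg_eq_add, mul_add]

end Symmetries

/-! ## §2 Charges `(+,−,+,−)`, any spins -/

section StdCharge

variable {N : ℕ}

omit [NeZero M] in
/-- A tuple on which the sectorised kernel vanishes identically has `fixedTupleL1 = 0`. -/
theorem fixedTupleL1_sectorisedKernel_eq_zero_of_forall {m : ℕ} (β : ℝ) (W : (Fin (m + 1) → SectorLeg N) → (Fin (m + 1) → SpaceTimeIdx L M) → ℂ)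
    (Ω : Fin (m + 1) → SectorLeg N) (h : ∀ x, W Ω x = 0) (x₁ : SpaceTimeIdx L M) : fixedTupleL1 L M β m W Ω x₁ = 0 := by
  unfold fixedTupleL1
  rw [sum_eq_zero fun y _ => by rw [h, norm_zero], mul_zero]

/-- **Charges `(+,−,+,−)`, ANY spins** (`β ≠ 0`): if every standard tuple `((ω i, (0,0,1,1) i), (0,1,0,1) i)` has `fixedTupleL1 … ≤ S` at every pin, then for every sector
string `ω` and EVERY spin string `s`, `fixedTupleL1 … ((ω i, s i), (0,1,0,1) i) x₁ ≤ 2·S`. -/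
theorem fixedTupleL1_sectorisedKernel_klEffectiveAction_stdCharge_le_two_mul {β : ℝ} (hβ : 0 < β) (F : Fin N → FreqMomentum L M → ℂ)
    (U μ : ℝ) (K : TrigPolyC4v) (e₀ : ℝ) (n : ℕ) {S : ℝ} (hS0 : 0 ≤ S)
    (hS : ∀ (ω : Fin 4 → Fin N) (x₁ : SpaceTimeIdx L M),
      fixedTupleL1 L M β 3 (sectorisedKernel L M β F (klEffectiveAction L M β U μ K e₀ n) 4)
        (fun i => ((ω i, ![(0 : Fin 2), 0, 1, 1] i), ![(0 : Fin 2), 1, 0, 1] i)) x₁ ≤ S)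
    (ω : Fin 4 → Fin N) (s : Fin 4 → Fin 2) (x₁ : SpaceTimeIdx L M) :
    fixedTupleL1 L M β 3 (sectorisedKernel L M β F (klEffectiveAction L M β U μ K e₀ n) 4)
      (fun i => ((ω i, s i), ![(0 : Fin 2), 1, 0, 1] i)) x₁ ≤ 2 * S := by
  set G := klEffectiveAction L M β U μ K e₀ n with hG
  set W := sectorisedKernel L M β F G 4 with hWdef
  have hfreq : ∀ (m : ℕ) (X : Fin m → HubbardFieldIdx L M),
      (∑ i, (if (X i).2 = 0 then (1 : ℤ) else -1) * matsubaraInt M (X i).1.1.1) ≠ 0 → kernel ℂ G m X = 0 :=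
    fun _ _ hX => kernel_klEffectiveAction_eq_zero_of_freq β U μ K e₀ n hX
  have hmom : ∀ (m : ℕ) (X : Fin m → HubbardFieldIdx L M), (∑ i, signedMomentum L (X i).2 (X i).1.1.2) ≠ 0 → kernel ℂ G m X = 0 :=
    fun m' X hX => klEffectiveAction_momentumConserving β U μ K e₀ n m' X hX
  -- spin patterns on the fixed sectors and charges
  set pat : (Fin 4 → Fin N) → (Fin 4 → Fin 2) → Fin 4 → SectorLeg N := fun w τ i => ((w i, τ i), ![(0 : Fin 2), 1, 0, 1] i) with hpat
  have hstd : ∀ w : Fin 4 → Fin N, ∀ x, fixedTupleL1 L M β 3 W (pat w ![0, 0, 1, 1]) x ≤ S := fun w x => hS w x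
  -- S_z selection
  have hsel : ∀ τ : Fin 4 → Fin 2,
      (∑ i, (if (pat ω τ i).2 = 0 then (1 : ℤ) else -1) * (if (pat ω τ i).1.2 = 0 then 1 else 0)) ≠ 0 → fixedTupleL1 L M β 3 W (pat ω τ) x₁ ≤ 2 * S := by
    intro τ hne
    rw [fixedTupleL1_sectorisedKernel_eq_zero_of_forall β W (pat ω τ) (fun x => sectorisedKernel_klEffectiveAction_eq_zero_of_spin β F U μ K e₀ n _ hne x) x₁]
    positivity
  have hP : ∀ a b c d : Fin 2, pat ω ![a, b, c, d] = ![((ω 0, a), 0), ((ω 1, b), 1), ((ω 2, c), 0), ((ω 3, d), 1)] := by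
    intro a b c d; funext i; fin_cases i <;> rfl
  have z0001 := hsel ![0, 0, 0, 1] (by
    simp only [hP, Fin.sum_univ_four, Fin.isValue, Matrix.cons_val_zero, Matrix.cons_val_one, Matrix.cons_val_two,
      Matrix.cons_val_three]
    norm_num)
  have z0010 := hsel ![0, 0, 1, 0] (by
    simp only [hP, Fin.sum_univ_four, Fin.isValue, Matrix.cons_val_zero, Matrix.cons_val_one, Matrix.cons_val_two,
      Matrix.cons_val_three]
    norm_num)
  have z0100 := hsel ![0, 1, 0, 0] (by
    simp only [hP, Fin.sum_univ_four, Fin.isValue, Matrix.cons_val_zero, Matrix.cons_val_one, Matrix.cons_val_two,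
      Matrix.cons_val_three]
    norm_num)
  have z1000 := hsel ![1, 0, 0, 0] (by
    simp only [hP, Fin.sum_univ_four, Fin.isValue, Matrix.cons_val_zero, Matrix.cons_val_one, Matrix.cons_val_two,
      Matrix.cons_val_three]
    norm_num)
  have z0111 := hsel ![0, 1, 1, 1] (by
    simp only [hP, Fin.sum_univ_four, Fin.isValue, Matrix.cons_val_zero, Matrix.cons_val_one, Matrix.cons_val_two,
      Matrix.cons_val_three]
    norm_num)
  have z1011 := hsel ![1, 0, 1, 1] (by
    simp only [hP, Fin.sum_univ_four, Fin.isValue, Matrix.cons_val_zero, Matrix.cons_val_one, Matrix.cons_val_two,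
      Matrix.cons_val_three]
    norm_num)
  have z1101 := hsel ![1, 1, 0, 1] (by
    simp only [hP, Fin.sum_univ_four, Fin.isValue, Matrix.cons_val_zero, Matrix.cons_val_one, Matrix.cons_val_two,
      Matrix.cons_val_three]
    norm_num)
  have z1110 := hsel ![1, 1, 1, 0] (by
    simp only [hP, Fin.sum_univ_four, Fin.isValue, Matrix.cons_val_zero, Matrix.cons_val_one, Matrix.cons_val_two,
      Matrix.cons_val_three]
    norm_num)
  have z0101 := hsel ![0, 1, 0, 1] (by
    simp only [hP, Fin.sum_univ_four, Fin.isValue, Matrix.cons_val_zero, Matrix.cons_val_one, Matrix.cons_val_two,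
      Matrix.cons_val_three]
    norm_num)
  have z1010 := hsel ![1, 0, 1, 0] (by
    simp only [hP, Fin.sum_univ_four, Fin.isValue, Matrix.cons_val_zero, Matrix.cons_val_one, Matrix.cons_val_two,
      Matrix.cons_val_three]
    norm_num)
  -- spin flip: `(1,1,0,0)` and `(1,1,1,1)`
  have hflip : ∀ τ : Fin 4 → Fin 2, ∀ x, W (pat ω (fun i => Equiv.swap (0 : Fin 2) 1 (τ i))) x = W (pat ω τ) x :=
    fun τ x => sectorisedKernel_klEffectiveAction_spinFlip β F U μ K e₀ n (pat ω τ) x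
  have hflipL1 : ∀ τ : Fin 4 → Fin 2, fixedTupleL1 L M β 3 W (pat ω (fun i => Equiv.swap (0 : Fin 2) 1 (τ i))) x₁ = fixedTupleL1 L M β 3 W (pat ω τ) x₁ := by
    intro τ; unfold fixedTupleL1; simp_rw [hflip τ]
  have f1100 : fixedTupleL1 L M β 3 W (pat ω ![1, 1, 0, 0]) x₁ = fixedTupleL1 L M β 3 W (pat ω ![0, 0, 1, 1]) x₁ := by
    rw [← hflipL1]; congr 2; funext i; fin_cases i <;> rfl
  have f1111 : fixedTupleL1 L M β 3 W (pat ω ![1, 1, 1, 1]) x₁ = fixedTupleL1 L M β 3 W (pat ω ![0, 0, 0, 0]) x₁ := by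
    rw [← hflipL1]; congr 2; funext i; fin_cases i <;> rfl
  -- leg transpositions: `(0,1,1,0)` and `(1,0,0,1)`
  have c0110 : ∀ x, fixedTupleL1 L M β 3 W (pat ω ![0, 1, 1, 0]) x ≤ S := by
    intro x
    have hX : pat (ω ∘ Equiv.swap (1 : Fin 4) 3) ![0, 0, 1, 1] ∘ (Equiv.swap (1 : Fin 4) 3) = pat ω ![0, 1, 1, 0] := by
      funext i; fin_cases i <;> rfl
    rw [← hX, hWdef, fixedTupleL1_sectorisedKernel_comp_perm hβ.ne' F G hfreq hmom]
    exact hstd _ x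
  have c1001 : ∀ x, fixedTupleL1 L M β 3 W (pat ω ![1, 0, 0, 1]) x ≤ S := by
    intro x
    have hX : pat (ω ∘ Equiv.swap (0 : Fin 4) 2) ![0, 0, 1, 1] ∘ (Equiv.swap (0 : Fin 4) 2) = pat ω ![1, 0, 0, 1] := by
      funext i; fin_cases i <;> rfl
    rw [← hX, hWdef, fixedTupleL1_sectorisedKernel_comp_perm hβ.ne' F G hfreq hmom]
    exact hstd _ x
  -- the equal-spin patterns: Ward at the sectorised level
  have c0000 : fixedTupleL1 L M β 3 W (pat ω ![0, 0, 0, 0]) x₁ ≤ 2 * S := by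
    have hε : 0 ≤ imagTimeWeight β M ^ 3 := pow_nonneg (imagTimeWeight_nonneg hβ.le M) 3
    have hpt : ∀ x, W (pat ω ![0, 0, 0, 0]) x = W (pat ω ![0, 0, 1, 1]) x + W (pat ω ![1, 0, 0, 1]) x := by
      intro x
      have e0 : pat ω ![0, 0, 0, 0] = fun i => ((ω i, (0 : Fin 2)), ![(0 : Fin 2), 1, 0, 1] i) := by funext i; fin_cases i <;> rfl
      rw [e0]
      exact sectorisedKernel_klEffectiveAction_sameSpin β F U μ K e₀ n ω x
    have h1 := hstd ω x₁
    have h2 := c1001 x₁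
    unfold fixedTupleL1 at h1 h2 ⊢
    calc imagTimeWeight β M ^ 3 * ∑ y : Fin 3 → SpaceTimeIdx L M, ‖W (pat ω ![0, 0, 0, 0]) (Matrix.vecCons x₁ y)‖
        ≤ imagTimeWeight β M ^ 3 * ∑ y : Fin 3 → SpaceTimeIdx L M,
            (‖W (pat ω ![0, 0, 1, 1]) (Matrix.vecCons x₁ y)‖ + ‖W (pat ω ![1, 0, 0, 1]) (Matrix.vecCons x₁ y)‖) :=
          mul_le_mul_of_nonneg_left (sum_le_sum fun y _ => by rw [hpt]; exact norm_add_le _ _) hε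
      _ = imagTimeWeight β M ^ 3 * ∑ y : Fin 3 → SpaceTimeIdx L M, ‖W (pat ω ![0, 0, 1, 1]) (Matrix.vecCons x₁ y)‖ +
            imagTimeWeight β M ^ 3 * ∑ y : Fin 3 → SpaceTimeIdx L M, ‖W (pat ω ![1, 0, 0, 1]) (Matrix.vecCons x₁ y)‖ := by
          rw [sum_add_distrib, mul_add]
      _ ≤ S + S := add_le_add h1 h2
      _ = 2 * S := by ring
  have c1111 : fixedTupleL1 L M β 3 W (pat ω ![1, 1, 1, 1]) x₁ ≤ 2 * S := by rw [f1111]; exact c0000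
  have c0011 : fixedTupleL1 L M β 3 W (pat ω ![0, 0, 1, 1]) x₁ ≤ 2 * S := by linarith [hstd ω x₁]
  have c1100 : fixedTupleL1 L M β 3 W (pat ω ![1, 1, 0, 0]) x₁ ≤ 2 * S := by rw [f1100]; exact c0011
  -- case on the spins
  show fixedTupleL1 L M β 3 W (pat ω s) x₁ ≤ 2 * S
  have hs : s = ![s 0, s 1, s 2, s 3] := by funext i; fin_cases i <;> rfl
  rw [hs]
  generalize s 0 = a₀; generalize s 1 = a₁; generalize s 2 = a₂; generalize s 3 = a₃
  fin_cases a₀ <;> fin_cases a₁ <;> fin_cases a₂ <;> fin_cases a₃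
  all_goals try simp only [Fin.zero_eta, Fin.mk_one, Fin.isValue]
  · exact c0000
  · exact z0001
  · exact z0010
  · exact c0011
  · exact z0100
  · exact z0101
  · linarith [c0110 x₁]
  · exact z0111
  · exact z1000
  · linarith [c1001 x₁]
  · exact z1010
  · exact z1011
  · exact c1100
  · exact z1101
  · exact z1110
  · exact c1111

end StdCharge

/-! ## §3 Any charges, and the class-#6 instance -/

section AnyPattern

variable {N : ℕ}

/-- **ALL spin AND charge patterns** (`0 < β`): under the standard-pattern hypothesis of §2, EVERY label 4-tuple `Ω` has `fixedTupleL1 … Ω x₁ ≤ 2·S` — charge-unbalanced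
tuples vanish (`sectorisedKernel_klEffectiveAction_eq_zero_of_charge`), balanced ones are leg permutations (`fixedTupleL1_sectorisedKernel_comp_perm`, any pin) of the
`(+,−,+,−)` order of §2. -/
theorem fixedTupleL1_sectorisedKernel_klEffectiveAction_le_two_mul_of_std {β : ℝ} (hβ : 0 < β) (F : Fin N → FreqMomentum L M → ℂ)
    (U μ : ℝ) (K : TrigPolyC4v) (e₀ : ℝ) (n : ℕ) {S : ℝ} (hS0 : 0 ≤ S)
    (hS : ∀ (ω : Fin 4 → Fin N) (x₁ : SpaceTimeIdx L M),
      fixedTupleL1 L M β 3 (sectorisedKernel L M β F (klEffectiveAction L M β U μ K e₀ n) 4)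
        (fun i => ((ω i, ![(0 : Fin 2), 0, 1, 1] i), ![(0 : Fin 2), 1, 0, 1] i)) x₁ ≤ S)
    (Ω : Fin 4 → SectorLeg N) (x₁ : SpaceTimeIdx L M) :
    fixedTupleL1 L M β 3 (sectorisedKernel L M β F (klEffectiveAction L M β U μ K e₀ n) 4) Ω x₁ ≤ 2 * S := by
  set G := klEffectiveAction L M β U μ K e₀ n with hG
  set W := sectorisedKernel L M β F G 4 with hWdef
  have hfreq : ∀ (m : ℕ) (X : Fin m → HubbardFieldIdx L M),
      (∑ i, (if (X i).2 = 0 then (1 : ℤ) else -1) * matsubaraInt M (X i).1.1.1) ≠ 0 → kernel ℂ G m X = 0 :=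
    fun _ _ hX => kernel_klEffectiveAction_eq_zero_of_freq β U μ K e₀ n hX
  have hmom : ∀ (m : ℕ) (X : Fin m → HubbardFieldIdx L M), (∑ i, signedMomentum L (X i).2 (X i).1.1.2) ≠ 0 → kernel ℂ G m X = 0 :=
    fun m' X hX => klEffectiveAction_momentumConserving β U μ K e₀ n m' X hX
  -- coordinates of `Ω`
  set w : Fin 4 → Fin N := fun i => (Ω i).1.1 with hw
  set s : Fin 4 → Fin 2 := fun i => (Ω i).1.2 with hs
  set c : Fin 4 → Fin 2 := fun i => (Ω i).2 with hc
  set pat : (Fin 4 → Fin 2) → Fin 4 → SectorLeg N := fun γ i => ((w i, s i), γ i) with hpat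
  have hΩ : Ω = pat c := by funext i; simp [hpat, hw, hs, hc]
  -- the standard order after a leg permutation `τ`
  have hstd : ∀ τ : Equiv.Perm (Fin 4), c ∘ τ = ![0, 1, 0, 1] → fixedTupleL1 L M β 3 W (pat c) x₁ ≤ 2 * S := by
    intro τ hτ
    have e1 : pat c = (pat c ∘ τ) ∘ τ.symm := by funext i; simp
    rw [e1, hWdef, fixedTupleL1_sectorisedKernel_comp_perm hβ.ne' F G hfreq hmom τ.symm]
    have hXτ : pat c ∘ τ = fun i => (((w ∘ τ) i, (s ∘ τ) i), ![(0 : Fin 2), 1, 0, 1] i) := by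
      funext i
      have hi : c (τ i) = ![(0 : Fin 2), 1, 0, 1] i := congrFun hτ i
      simp only [Function.comp_apply, hpat, hi]
    rw [hXτ]
    exact fixedTupleL1_sectorisedKernel_klEffectiveAction_stdCharge_le_two_mul hβ F U μ K e₀ n hS0 hS (w ∘ τ) (s ∘ τ) x₁
  -- charge selection
  have hsel : ∀ γ : Fin 4 → Fin 2, (∑ i, (if (pat γ i).2 = 0 then (1 : ℤ) else -1)) ≠ 0 → fixedTupleL1 L M β 3 W (pat γ) x₁ ≤ 2 * S := by
    intro γ hne
    rw [fixedTupleL1_sectorisedKernel_eq_zero_of_forall β W (pat γ) (fun x => sectorisedKernel_klEffectiveAction_eq_zero_of_charge β F U μ K e₀ n _ hne x) x₁]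
    positivity
  have hPc : ∀ a b d e : Fin 2, pat ![a, b, d, e] = ![((w 0, s 0), a), ((w 1, s 1), b), ((w 2, s 2), d), ((w 3, s 3), e)] := by
    intro a b d e; funext i; fin_cases i <;> rfl
  rw [hΩ]
  have hcv : c = ![c 0, c 1, c 2, c 3] := by funext i; fin_cases i <;> rfl
  have key : ∀ a b d e : Fin 2, c = ![a, b, d, e] → fixedTupleL1 L M β 3 W (pat c) x₁ ≤ 2 * S := by
    intro a b d e hce
    have unb : ∀ γ : Fin 4 → Fin 2, c = γ → (∑ i, (if (pat γ i).2 = 0 then (1 : ℤ) else -1)) ≠ 0 → fixedTupleL1 L M β 3 W (pat c) x₁ ≤ 2 * S :=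
      fun γ hγ hne => by rw [hγ]; exact hsel γ hne
    have bal : ∀ γ : Fin 4 → Fin 2, c = γ → ∀ τ : Equiv.Perm (Fin 4), γ ∘ τ = ![0, 1, 0, 1] → fixedTupleL1 L M β 3 W (pat c) x₁ ≤ 2 * S :=
      fun γ hγ τ hτ => hstd τ (by rw [hγ]; exact hτ)
    fin_cases a <;> fin_cases b <;> fin_cases d <;> fin_cases e
    all_goals try simp only [Fin.zero_eta, Fin.mk_one, Fin.isValue] at hce
    · exact unb _ hce (by
      simp only [hPc, Fin.sum_univ_four, Fin.isValue, Matrix.cons_val_zero, Matrix.cons_val_one, Matrix.cons_val_two,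
        Matrix.cons_val_three]
      norm_num)
    · exact unb _ hce (by
      simp only [hPc, Fin.sum_univ_four, Fin.isValue, Matrix.cons_val_zero, Matrix.cons_val_one, Matrix.cons_val_two,
        Matrix.cons_val_three]
      norm_num)
    · exact unb _ hce (by
      simp only [hPc, Fin.sum_univ_four, Fin.isValue, Matrix.cons_val_zero, Matrix.cons_val_one, Matrix.cons_val_two,
        Matrix.cons_val_three]
      norm_num)
    · exact bal _ hce (Equiv.swap (1 : Fin 4) 2) (by funext i; fin_cases i <;> rfl)
    · exact unb _ hce (by
      simp only [hPc, Fin.sum_univ_four, Fin.isValue, Matrix.cons_val_zero, Matrix.cons_val_one, Matrix.cons_val_two,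
        Matrix.cons_val_three]
      norm_num)
    · exact bal _ hce (Equiv.refl _) (by funext i; fin_cases i <;> rfl)
    · exact bal _ hce (Equiv.swap (2 : Fin 4) 3) (by funext i; fin_cases i <;> rfl)
    · exact unb _ hce (by
      simp only [hPc, Fin.sum_univ_four, Fin.isValue, Matrix.cons_val_zero, Matrix.cons_val_one, Matrix.cons_val_two,
        Matrix.cons_val_three]
      norm_num)
    · exact unb _ hce (by
      simp only [hPc, Fin.sum_univ_four, Fin.isValue, Matrix.cons_val_zero, Matrix.cons_val_one, Matrix.cons_val_two,
        Matrix.cons_val_three]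
      norm_num)
    · exact bal _ hce (Equiv.swap (0 : Fin 4) 1) (by funext i; fin_cases i <;> rfl)
    · exact bal _ hce ((Equiv.swap (0 : Fin 4) 1) * (Equiv.swap (2 : Fin 4) 3)) (by funext i; fin_cases i <;> rfl)
    · exact unb _ hce (by
      simp only [hPc, Fin.sum_univ_four, Fin.isValue, Matrix.cons_val_zero, Matrix.cons_val_one, Matrix.cons_val_two,
        Matrix.cons_val_three]
      norm_num)
    · exact bal _ hce ((Equiv.swap (1 : Fin 4) 2) * ((Equiv.swap (0 : Fin 4) 1) * (Equiv.swap (2 : Fin 4) 3)))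
        (by funext i; fin_cases i <;> rfl)
    · exact unb _ hce (by
      simp only [hPc, Fin.sum_univ_four, Fin.isValue, Matrix.cons_val_zero, Matrix.cons_val_one, Matrix.cons_val_two,
        Matrix.cons_val_three]
      norm_num)
    · exact unb _ hce (by
      simp only [hPc, Fin.sum_univ_four, Fin.isValue, Matrix.cons_val_zero, Matrix.cons_val_one, Matrix.cons_val_two,
        Matrix.cons_val_three]
      norm_num)
    · exact unb _ hce (by
      simp only [hPc, Fin.sum_univ_four, Fin.isValue, Matrix.cons_val_zero, Matrix.cons_val_one, Matrix.cons_val_two,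
        Matrix.cons_val_three]
      norm_num)
  exact key (c 0) (c 1) (c 2) (c 3) hcv

/-- **THE CLASS-#6 INSTANCE (M4 (i) done at the `L¹` level)**: for `𝒱ₙ[K]` sectorised at isotropic resolution `m` (`0 < β`), if every STANDARD iso tuple
`((ω i, (0,0,1,1) i), (0,1,0,1) i)` has `fixedTupleL1 β 3 (klIsoKernelAt … K n m) Ω_std x₁ ≤ S` at every pin, then EVERY label 4-tuple `Ω` has
`fixedTupleL1 β 3 (klIsoKernelAt … K n m) Ω x₁ ≤ 2·S`. -/
theorem fixedTupleL1_klIsoKernelAt_le_two_mul_of_std {β : ℝ} (hβ : 0 < β) (U μ : ℝ) (K : TrigPolyC4v) (n m : ℕ) {S : ℝ} (hS0 : 0 ≤ S)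
    (hS : ∀ (ω : Fin 4 → Fin (sectorCount (2 * m))) (x₁ : SpaceTimeIdx L M),
      fixedTupleL1 L M β 3 (klIsoKernelAt L M β U μ K n m) (fun i => ((ω i, ![(0 : Fin 2), 0, 1, 1] i), ![(0 : Fin 2), 1, 0, 1] i)) x₁ ≤ S)
    (Ω : Fin 4 → SectorLeg (sectorCount (2 * m))) (x₁ : SpaceTimeIdx L M) :
    fixedTupleL1 L M β 3 (klIsoKernelAt L M β U μ K n m) Ω x₁ ≤ 2 * S :=
  fixedTupleL1_sectorisedKernel_klEffectiveAction_le_two_mul_of_std hβ (klIsoFamily L M β μ K klE0 m) U μ K klE0 n hS0 hS Ω x₁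

end AnyPattern

end Summit.HubbardSuperconductivity.HubbardSuperconductivity.Theorems.EngineV8

end
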